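import Literature.MathematicalPhysics.QuantumFieldTheory.Balaban1983to89.Node00.Record13LiveSelector
import Literature.MathematicalPhysics.QuantumFieldTheory.Balaban1983to89.Node00.Record13CoPH
import Literature.MathematicalPhysics.QuantumFieldTheory.Balaban1983to89.B16RLeafRecord12Live
import Summits.QuantumFields.YangMills.Theorems.BalabanUVNodesN21StepWeightsPositivity

/-!
# BalabanUVNodes ∕ N13 — THE (UV₁₃) ROW IS 𝐑-FREE AT EVERY LIVE-SELECTOR PARAMETER: the post-𝐑 slot of record is the pre-𝐑 slot times its own (0.3) ratio
# `∈ {0,1}`, so `ρ_{k+1} ≤ 𝐓ρ_k` at EVERY field and both halves of [B16] (0.1) ∕ [III] Cor. 3 (2.50) at level `k+1` may be SUPPLIED ON THE 𝐓-IMAGE; and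
# (LOCATED) the 𝐓-image is `avgDensity · bracket` — an everywhere bound on it is a statement about the chosen marginal-density VERSION

Cell `pub-ymgap` (D-0062 Track A ∕ D-0149 width), WIDTH SEAT `pub-ymgap-dag-n13-w1` (gen 4), node N13 [B16].  Key of record K1⁷ `StabilityBAtRecordR13SepCoPH`
= stmt-QuantumFields-20542 (`--kind proof --supports … --as helper`; count-neutral).  Skeleton of record v6 (plan g82); this file serves stub 1's N13 child `hUV`
at its witnesses (dag-n24-c 30H∕34H), all LIVE RE-PINS `θ₁₅ᶜᶜᴹᵂ = Node00.theta13LiveOfNumerics … = (…).liveRepin₁₃` (`rfl`).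
[III] = [Balaban1988Convergent], [IV] = [Balaban1989LargeFieldI], [B16] = [Balaban1989LargeFieldII].

WHY.  (UV₁₃) reads the post-𝐑 density `ρ_{k+1} = Σ_s χ_{k+1}(s)·slot_{k+1}(s)` (`Node00.densOfRecord₁₃`), `slot_{k+1} = 𝐑_{sel}(slotT_{k+1})` (def-R's (0.3)
re-indexed by the `p–p′` selector, `Node00.rstepSlot`; [IV] p. 176, p. 177 (i)–(ii)).  At K0a's LIVE selector (`Node00.liveSelOfSlot`: identity on live sequences,
every other sequence — DEAD, i.e. of zero own fibre mass, `B16RLeafRecord12Live.fibreIntegral_rterm_eq_zero_of_not_live` — carried onto a live one) the (0.3)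
sum over the selector fibre of `s` collapses to the diagonal ratio `∫⌈t_s ∕ ∫⌈t_s ∈ {0,1}`: **the 𝐑-step at the live selector IS the 𝐑-step at the identity
selector** (§1; N19's `…MGFRoadLiveSelectorTower` §9 has the same identity in F3's dressed-tower currency — here bare, from K0a's module).  Hence (§2)
`0 ≤ slot_{k+1} ≤ slotT_{k+1}` and ★ `ρ_{k+1}(V) ≤ 𝐓ρ_k(V)` at EVERY `V` (`= a.e.` was known, `B16RLeafRecord13…_succ_ae_eq_tdens…`), with termwise EQUALITY at
every history with empty fibre bond set `Z′(s) = ∅` (the all-small history).  So (§3) the UPPER half of (UV₁₃) at level `k+1` follows from the same bound for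
`Node00.tdensOfRecord₁₃ θ P k` — or from per-history majorants of the PRE-𝐑 terms plus a budget ((U1)ᵀ+(U2)) — and the LOWER half from a lower bound on the
pre-𝐑 term of ONE empty-fibre history ((L2)ᵀ): NO [IV] (1.1)-type estimate on 𝐑 enters N13's row at these parameters; what remains is [III] §3 ∕ Thm 2's
description of the 𝐓-image (N11's (S1ᵀ) currency `Node00.slotsTOfRecord`).  §3b keys the same on `Provisos₁₃CoPH`; §4 instantiates at `θ.liveRepin₁₃` (selector clause `rfl`).
§5 (LOCATED, reading only): by def-T's (†) (`Node00.texpASucc_apply`) `𝐓ρ_k(V′) = avgDensity(V′)·Σ_{s′} χ_{k+1}(s′)(V′)·∫(w·χ_k·slot_k)(init s′) ∂avgKernel(V′)`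
with `avgDensity = T4AveragingDisintegration.margDensity = rnNN` = Mathlib's chosen `Measure.rnDeriv` version; so an EVERYWHERE upper bound on `𝐓ρ_k` (every
everywhere-(U) road through the 𝐓-image) bounds that version at each `V′` where the bracket is alive, while the tree knows it only `dV′`-a.e.
(`withDensity_margDensity`) — the (UV₁₃)-row instance at Stage 13 of the cell's version readings (dag-n13-b TS-4 INBOX l.9746; def-T ERRATUM-VERSION l.11075).

CONTENTS (theorems only; 0 `def`).  §1 generic (`rstepOfSel_TexpA_eq_id_of_fix_of_dead`, `rstepOfSel_TexpA_eq_zero_of_forall_sel_ne`,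
`fibreIntegral_rterm_slice_eq_zero_of_not_liveSeq`, ★ `rstepSlot_liveSel_eq_rstepSlot_id`, `rstepSlot_id_le`, `rstepSlot_liveSel_le`,
`rstepSlot_id_eq_self_of_fibreIntegral_ne_zero`, `rterm_sliceOfRecord_apply`, `fibreIntegral_empty_rterm_slice`,
`chi_mul_rstepSlot_id_eq_of_fibOfSeq_eq_empty`) · §2 record (`slotsOfRecord₁₃_succ_eq_rstepSlot_id_of_liveSel`, `wOfRecord₉_nonneg`,
`slotsOfRecord₁₃_succ_le_slotsT_of_liveSel`, ★ `densOfRecord₁₃_succ_le_tdens_of_liveSel`, `histTerm₁₃_succ_eq_histTermT_of_fibOfSeq_eq_empty_of_liveSel`) · §3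
(★★ `uvUpper₁₃_succ_of_tdens_le_of_liveSel`, ★★ `uvUpper₁₃_succ_of_U1T_U2_of_liveSel`, ★★ `uvLower₁₃_succ_of_L2T_of_fibOfSeq_eq_empty_of_liveSel`) · §3b (`Provisos₁₃CoPH`-keyed:
`densOfRecord₁₃_succ_le_tdens_of_provisos_of_liveSel`, `uvUpper₁₃_succ_of_tdens_le_of_provisos_of_liveSel`)
· §4 (`densOfRecord₁₃_succ_le_tdens_liveRepin₁₃`) · §5 (`tdensOfRecord₁₃_eq_avgDensity_mul_sum`, `avgDensity_mul_le_of_tdens_le`).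

HONEST FRAMING.  Count-neutral structural bookkeeping (finite sums; K0a's live selector; def-R's (0.3) ratios; one fibre fact already in the tree; def-T's (†)
unfolded); nothing of Bałaban's asserted; the (U)∕(L) content of (UV₁₃) is NOT supplied — it is RE-ADDRESSED to the 𝐓-image (and, §5, read at `k ≥ 1` as a
statement about an `rnDeriv`∕`condKernel` version); N13 NOT discharged; K0⁷∕K1⁷ NOT closed; no stub closed; counts unmoved (typed 28∕28 · discharged 5∕27, A 5∕28);
one finite `𝕋⁴_{L^K}` programme at fixed `ε = L^{−K}`; route R4 closes the CONDITIONAL finite-𝕋⁴ rung `BalabanLadder.UV` only — the Yang–Mills mass gap (Clay) is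
NOT proved by any of this.  No `sorry`, no `def`, no `instance`, no `notation`.
-/

noncomputable section

open scoped BigOperators Matrix.Norms.L2Operator

namespace Summit.QuantumFields.YangMills.BalabanUVNodes.N13UVRowRFreeAtLiveSelectorRecord13

open MeasureTheory
open Literature.MathematicalPhysics.QuantumFieldTheory.Balaban1983to89
open Literature.MathematicalPhysics.QuantumFieldTheory.Balaban1983to89.T4Continuum (T4Family)
open Literature.MathematicalPhysics.QuantumFieldTheory.Balaban1983to89.Node00
open B14.Eq218Concrete
open B15.BasicStep (fibreIntegral)
open B16RLeafRecord12Live (fibreIntegral_rterm_eq_zero_of_not_live rratio_eq_zero_of_dead)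
open Summit.QuantumFields.YangMills.Theorems.N21StepWeightsPositivity (zetaOfRecord_nonneg)

variable {F : T4Family} {N : ℕ} [NeZero N]

/-! ## §1 GENERIC: the 𝐑-step at K0a's live selector of a slot family IS the 𝐑-step at the identity selector -/

section Repr

variable {P : Params} {G : Type*} [GaugeGroup G] [MeasurableSpace G] [HaarData G] {j : ℕ}

open Classical in
/-- **(0.3) re-indexed, at a FIXED POINT receiving only DEAD sequences, is (0.3) at the identity selector** (generic over def-R's `Step.Repr218`; the fibre sum
`Σ_{a : sel a = a′} ∫⌈t_a ∕ ∫⌈t_{a′}` is its diagonal term, `rratio_eq_zero_of_dead`; instance binder implicit, unified with the caller's). [cite: Balaban1989LargeFieldI, (0.3) p.176 and p.177 (i)–(ii)] -/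
theorem rstepOfSel_TexpA_eq_id_of_fix_of_dead {hP : DecidableEq (PBond P j)} (r : Step.Repr218 P G j) (sel : r.Adm → r.Adm)
    (fib : r.Adm → Finset (PBond P j)) {a' : r.Adm} (hfix : sel a' = a')
    (hdead : ∀ a, sel a = a' → a ≠ a' → ∀ V, fibreIntegral (fib a) (rterm r a) V = 0) (V : GaugeField P j G) :
    (rstepOfSel r sel fib).TexpA a' V = (rstepOfSel r id fib).TexpA a' V := by
  rw [rstepOfSel_TexpA, rstepOfSel_TexpA]
  congr 1
  have hSid : Finset.univ.filter (fun a : r.Adm => id a = a') = {a'} := by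
    ext a
    simp only [Finset.mem_filter, Finset.mem_univ, true_and, id_eq, Finset.mem_singleton]
  rw [hSid, Finset.sum_singleton]
  have hmem : a' ∈ Finset.univ.filter (fun a : r.Adm => sel a = a') := Finset.mem_filter.mpr ⟨Finset.mem_univ _, hfix⟩
  rw [← Finset.add_sum_erase _ _ hmem, Finset.sum_eq_zero, add_zero]
  intro a ha
  obtain ⟨hne, ha'⟩ := Finset.mem_erase.mp ha
  exact rratio_eq_zero_of_dead r fib a (hdead a (Finset.mem_filter.mp ha').2 hne) a' V

open Classical in
/-- **(0.3) re-indexed gives `0` at a sequence NOTHING is selected onto** (empty fibre sum). [cite: Balaban1989LargeFieldI, (0.3) p.176 (bookkeeping)] -/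
theorem rstepOfSel_TexpA_eq_zero_of_forall_sel_ne {hP : DecidableEq (PBond P j)} (r : Step.Repr218 P G j) (sel : r.Adm → r.Adm)
    (fib : r.Adm → Finset (PBond P j)) {a' : r.Adm} (hne : ∀ a, sel a ≠ a') (V : GaugeField P j G) :
    (rstepOfSel r sel fib).TexpA a' V = 0 := by
  rw [rstepOfSel_TexpA]
  have hS : Finset.univ.filter (fun a : r.Adm => sel a = a') = ∅ := by
    ext a
    simp only [Finset.mem_filter, Finset.mem_univ, true_and, Finset.notMem_empty, iff_false]
    exact hne a
  rw [hS, Finset.sum_empty, mul_zero]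

end Repr

section Generic

variable {ν : Stage7Numerics} {τ : TowerNumerics} {p : B12.RunParams} {g : ℕ → ℝ} {k : ℕ}

/-- **A NON-LIVE sequence has ZERO own fibre mass** `∫⌈_{Z′(a)} χ_k(a)·f(a) ≡ 0` (K0a's `LiveSeq` through `B16RLeafRecord12Live.fibreIntegral_rterm_eq_zero_of_not_live`,
bridge `liveSeq_of_ne_zero`; explicit instance binder, met by unification). [cite: Balaban1989LargeFieldI, (0.3) p.176 (bookkeeping)] -/
theorem fibreIntegral_rterm_slice_eq_zero_of_not_liveSeq (iP : DecidableEq (PBond (F.P p.K) k)) (f : TexpASlot F N ν τ.M p g k)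
    {a : SeqOfRecord F ν τ.M g p.K k} (ha : ¬ LiveSeq F N ν τ p g k f a) (V : GaugeField (F.P p.K) k (SU N)) :
    @fibreIntegral (F.P p.K) k (SU N) _ _ _ iP (fibOfSeq F ν τ p g k a) (rterm (sliceOfRecord F N ν τ.M p g k f) a) V = 0 :=
  fibreIntegral_rterm_eq_zero_of_not_live (hP := iP) (sliceOfRecord F N ν τ.M p g k f) (fibOfSeq F ν τ p g k) a
    (fun ⟨_, hT, hI⟩ => ha (liveSeq_of_ne_zero F N iP hT hI)) V

/-- **★ THE 𝐑-STEP AT THE LIVE SELECTOR IS THE 𝐑-STEP AT THE IDENTITY SELECTOR**, for EVERY sequence and EVERY field (no sign ∕ measurability hypothesis): a live `s`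
is a fixed point whose selector fibre is `s` plus DEAD sequences (zero (0.3) ratios); a non-live `s` gets `0` from both selectors (identity: by the definition of
`LiveSeq`; live: empty fibre when some sequence is live, and the live selector IS the identity when none is). [cite: Balaban1989LargeFieldI, (0.3) p.176 and p.177 (i)–(ii)] -/
theorem rstepSlot_liveSel_eq_rstepSlot_id (f : TexpASlot F N ν τ.M p g k) (s : SeqOfRecord F ν τ.M g p.K k) (V : GaugeField (F.P p.K) k (SU N)) :
    rstepSlot F N ν τ p g k (liveSelOfSlot F N ν τ p g k f) f s V = rstepSlot F N ν τ p g k id f s V := by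
  by_cases hs : LiveSeq F N ν τ p g k f s
  · have hdead : ∀ a, liveSelOfSlot F N ν τ p g k f a = s → a ≠ s → ¬ LiveSeq F N ν τ p g k f a :=
      fun a ha hne hl => hne ((liveSelOfSlot_of_live F N hl).symm.trans ha)
    unfold rstepSlot
    exact rstepOfSel_TexpA_eq_id_of_fix_of_dead (sliceOfRecord F N ν τ.M p g k f) (liveSelOfSlot F N ν τ p g k f) (fibOfSeq F ν τ p g k)
      (liveSelOfSlot_of_live F N hs) (fun a ha hne W => fibreIntegral_rterm_slice_eq_zero_of_not_liveSeq _ f (hdead a ha hne) W) V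
  · have hR : rstepSlot F N ν τ p g k id f s V = 0 := by
      by_contra h
      exact hs ⟨V, h⟩
    rw [hR]
    by_cases hex : ∃ s', LiveSeq F N ν τ p g k f s'
    · have hne : ∀ a, liveSelOfSlot F N ν τ p g k f a ≠ s := fun a h => hs (h ▸ liveSeq_liveSelOfSlot F N hex a)
      unfold rstepSlot
      exact rstepOfSel_TexpA_eq_zero_of_forall_sel_ne (sliceOfRecord F N ν τ.M p g k f) (liveSelOfSlot F N ν τ p g k f) (fibOfSeq F ν τ p g k) hne V
    · have hid : liveSelOfSlot F N ν τ p g k f = id := funext (liveSelOfSlot_of_none F N hex)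
      rw [hid]
      exact hR

/-- **The identity-selector 𝐑-step does not increase a non-negative slot value**: `𝐑_id f(s)(V) = f(s)(V)·(∫⌈t_s ∕ ∫⌈t_s) ≤ f(s)(V)` (def-R's `rstepOfSel_id_TexpA`;
K0's `rstepSlot_ppSelId_le` is the same fact at the named selector `ppSelIdOfRecord`). [cite: Balaban1989LargeFieldI, (0.3) p.176 (bookkeeping)] -/
theorem rstepSlot_id_le (f : TexpASlot F N ν τ.M p g k) {s : SeqOfRecord F ν τ.M g p.K k} {V : GaugeField (F.P p.K) k (SU N)} (hf : 0 ≤ f s V) :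
    rstepSlot F N ν τ p g k id f s V ≤ f s V := by
  unfold rstepSlot
  refine (rstepOfSel_id_TexpA N _ (sliceOfRecord F N ν τ.M p g k f) (fibOfSeq F ν τ p g k) s V).trans_le ?_
  unfold rratio
  exact mul_le_of_le_one_right hf (div_self_le_one _)

/-- **At the live selector the 𝐑-step does not increase a non-negative slot value**: `0 ≤ f(s)(V) ⇒ 𝐑_live f (s)(V) ≤ f(s)(V)`.
[cite: Balaban1989LargeFieldI, (0.3) p.176 and p.177 (i)–(ii) (bookkeeping)] -/
theorem rstepSlot_liveSel_le (f : TexpASlot F N ν τ.M p g k) {s : SeqOfRecord F ν τ.M g p.K k} {V : GaugeField (F.P p.K) k (SU N)}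
    (hf : 0 ≤ f s V) : rstepSlot F N ν τ p g k (liveSelOfSlot F N ν τ p g k f) f s V ≤ f s V := by
  rw [rstepSlot_liveSel_eq_rstepSlot_id]
  exact rstepSlot_id_le f hf

/-- **Where the own fibre integral is non-zero the identity-selector 𝐑-step IS the slot** (own ratio `= 1`; the `DecidableEq` instance of the hypothesis is
arbitrary — `fibreIntegral_instIrrel`). [cite: Balaban1989LargeFieldI, (0.3) p.176 (bookkeeping)] -/
theorem rstepSlot_id_eq_self_of_fibreIntegral_ne_zero {iP : DecidableEq (PBond (F.P p.K) k)} (f : TexpASlot F N ν τ.M p g k)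
    {s : SeqOfRecord F ν τ.M g p.K k} {V : GaugeField (F.P p.K) k (SU N)}
    (hI : @fibreIntegral (F.P p.K) k (SU N) _ _ _ iP (fibOfSeq F ν τ p g k s) (rterm (sliceOfRecord F N ν τ.M p g k f) s) V ≠ 0) :
    rstepSlot F N ν τ p g k id f s V = f s V := by
  unfold rstepSlot
  refine (rstepOfSel_id_TexpA N _ (sliceOfRecord F N ν τ.M p g k f) (fibOfSeq F ν τ p g k) s V).trans ?_
  unfold rratio
  rw [fibreIntegral_instIrrel _ iP, div_self hI]
  exact mul_one _

/-- The term of the slice at `(s, V)` is `χ_k(s)(V)·f(s)(V)` (`rfl`). [cite: Balaban1988Convergent, (2.18) p.257 (bookkeeping)] -/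
theorem rterm_sliceOfRecord_apply (f : TexpASlot F N ν τ.M p g k) (s : SeqOfRecord F ν τ.M g p.K k) (V : GaugeField (F.P p.K) k (SU N)) :
    rterm (sliceOfRecord F N ν τ.M p g k f) s V = chiSeqOfRecord F N ν τ.M g p.K k s V * f s V := rfl

/-- **Over the EMPTY fibre bond set the restricted integral of the term IS the (non-negative) term value** (`MeasureTheory.lmarginal_empty`).
[cite: Balaban1989LargeFieldI, (0.3) p.176 (bookkeeping)] -/
theorem fibreIntegral_empty_rterm_slice {iP : DecidableEq (PBond (F.P p.K) k)} (f : TexpASlot F N ν τ.M p g k) {s : SeqOfRecord F ν τ.M g p.K k}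
    {V : GaugeField (F.P p.K) k (SU N)} (hf : 0 ≤ f s V) :
    @fibreIntegral (F.P p.K) k (SU N) _ _ _ iP ∅ (rterm (sliceOfRecord F N ν τ.M p g k f) s) V = chiSeqOfRecord F N ν τ.M g p.K k s V * f s V := by
  simp only [fibreIntegral, lmarginal_empty, rterm_sliceOfRecord_apply]
  exact ENNReal.toReal_ofReal (mul_nonneg (chiSeqOfRecord_nonneg F N ν τ.M g p.K k s V) hf)

/-- **AT A HISTORY WITH EMPTY FIBRE BOND SET (`Z′(s) = ∅`, e.g. the all-small history) THE TERM IS UNCHANGED BY THE IDENTITY-SELECTOR 𝐑-STEP**: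
`χ_k(s)(V)·𝐑_id f(s)(V) = χ_k(s)(V)·f(s)(V)` (own ratio `1` where the term is non-zero; both sides `0` where it vanishes). [cite: Balaban1989LargeFieldI, (0.3) p.176 (bookkeeping)] -/
theorem chi_mul_rstepSlot_id_eq_of_fibOfSeq_eq_empty (f : TexpASlot F N ν τ.M p g k) {s : SeqOfRecord F ν τ.M g p.K k}
    (hfib : fibOfSeq F ν τ p g k s = ∅) {V : GaugeField (F.P p.K) k (SU N)} (hf : 0 ≤ f s V) :
    chiSeqOfRecord F N ν τ.M g p.K k s V * rstepSlot F N ν τ p g k id f s V = chiSeqOfRecord F N ν τ.M g p.K k s V * f s V := by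
  by_cases ht : chiSeqOfRecord F N ν τ.M g p.K k s V * f s V = 0
  · obtain h0 | h0 := mul_eq_zero.mp ht
    · rw [h0, zero_mul, zero_mul]
    · have hR : rstepSlot F N ν τ p g k id f s V = 0 := by
        unfold rstepSlot
        refine (rstepOfSel_id_TexpA N _ (sliceOfRecord F N ν τ.M p g k f) (fibOfSeq F ν τ p g k) s V).trans ?_
        exact mul_eq_zero_of_left h0 _
      rw [hR, h0]
  · have hI : fibreIntegral (fibOfSeq F ν τ p g k s) (rterm (sliceOfRecord F N ν τ.M p g k f) s) V ≠ 0 := by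
      rw [hfib, fibreIntegral_empty_rterm_slice f hf]
      exact ht
    rw [rstepSlot_id_eq_self_of_fibreIntegral_ne_zero f hI]

end Generic

/-! ## §2 THE STAGE-13 RECORD AT A LIVE-SELECTOR PARAMETER: post-𝐑 slot = identity-selector 𝐑-step of the pre-𝐑 slot; `ρ_{k+1} ≤ 𝐓ρ_k` everywhere -/

section Record

variable (θ : Stage13Params F N)

/-- **At a `θ` whose `p–p′` selector IS K0a's live selector of record (node00-def-T's selector clause `hsel`; every `θ.liveRepin₁₃`, every witness
`theta13LiveOfNumerics`), the post-𝐑 slot of record at level `k+1` IS the identity-selector 𝐑-step of the pre-𝐑 slot**: `slot_{k+1}(s) = slotT_{k+1}(s)·(∫⌈t_s ∕ ∫⌈t_s)`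
(K0a's `slotsOfRecord_ppSelLive_succ_eq` + §1). [cite: Balaban1989LargeFieldI, (0.3) p.176 and p.177 (i)–(ii); Balaban1988Convergent, (2.18) p.257, (3.24) p.270] -/
theorem slotsOfRecord₁₃_succ_eq_rstepSlot_id_of_liveSel
    (hsel : θ.ppSel = ppSelLiveOfRecord F N θ.ν θ.τ9 (EOfRecord₁₃ F N θ) (wOfRecord₉ F N θ.toStage9Params))
    (P : B12.RunParams) (k : ℕ) (s : SeqOfRecord F θ.ν θ.τ9.M (gOfRecord₁₃ F N θ P) P.K (k + 1)) (V : GaugeField (F.P P.K) (k + 1) (SU N)) :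
    slotsOfRecord F N θ.ν θ.τ9 (EOfRecord₁₃ F N θ) (wOfRecord₉ F N θ.toStage9Params) θ.ppSel P (gOfRecord₁₃ F N θ P) (k + 1) s V =
      rstepSlot F N θ.ν θ.τ9 P (gOfRecord₁₃ F N θ P) (k + 1) id
        (slotsTOfRecord F N θ.ν θ.τ9 (EOfRecord₁₃ F N θ) (wOfRecord₉ F N θ.toStage9Params) θ.ppSel P (gOfRecord₁₃ F N θ P) (k + 1)) s V := by
  rw [hsel, slotsOfRecord_ppSelLive_succ_eq]
  exact rstepSlot_liveSel_eq_rstepSlot_id _ s V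

/-- The step weights of record are `≥ 0` under the two DISPLAYED ζ-laws (`zetaOfRecord_nonneg`, `wOfRecord_nonneg`). [cite: Balaban1988Convergent, (3.16) p.268 (bookkeeping)] -/
theorem wOfRecord₉_nonneg (hζu : IsZetaUnity F N θ.ν θ.τ9.M θ.ζ) (hζa : IsZetaAbsLeOne F N θ.ν θ.τ9.M θ.ζ) :
    ∀ p g k s' U V', 0 ≤ wOfRecord₉ F N θ.toStage9Params p g k s' U V' :=
  fun p' g' j s' U V' => wOfRecord_nonneg F N θ.ν θ.τ9.M p' g' j θ.A₁ (zetaOfRecord_nonneg F N θ.ν θ.τ9.M hζu hζa) s' U V'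

/-- **`0 ≤ slot_{k+1}(s)(V) ≤ slotT_{k+1}(s)(V)` at a live-selector parameter** (pre-𝐑 slots are `≥ 0` at non-negative step weights, K0's `slotsTOfRecord_nonneg`; the own ratio is `≤ 1`).
[cite: Balaban1989LargeFieldI, (0.3) p.176 and p.177 (i)–(ii); Balaban1988Convergent, (3.24)–(3.25) p.270] -/
theorem slotsOfRecord₁₃_succ_le_slotsT_of_liveSel (hζu : IsZetaUnity F N θ.ν θ.τ9.M θ.ζ) (hζa : IsZetaAbsLeOne F N θ.ν θ.τ9.M θ.ζ)
    (hsel : θ.ppSel = ppSelLiveOfRecord F N θ.ν θ.τ9 (EOfRecord₁₃ F N θ) (wOfRecord₉ F N θ.toStage9Params))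
    (P : B12.RunParams) (k : ℕ) (s : SeqOfRecord F θ.ν θ.τ9.M (gOfRecord₁₃ F N θ P) P.K (k + 1)) (V : GaugeField (F.P P.K) (k + 1) (SU N)) :
    slotsOfRecord F N θ.ν θ.τ9 (EOfRecord₁₃ F N θ) (wOfRecord₉ F N θ.toStage9Params) θ.ppSel P (gOfRecord₁₃ F N θ P) (k + 1) s V ≤
      slotsTOfRecord F N θ.ν θ.τ9 (EOfRecord₁₃ F N θ) (wOfRecord₉ F N θ.toStage9Params) θ.ppSel P (gOfRecord₁₃ F N θ P) (k + 1) s V := by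
  rw [slotsOfRecord₁₃_succ_eq_rstepSlot_id_of_liveSel θ hsel P k s V]
  exact rstepSlot_id_le _ (slotsTOfRecord_nonneg F N θ.ν θ.τ9 (EOfRecord₁₃ F N θ) (wOfRecord₉_nonneg θ hζu hζa) θ.ppSel P _ (k + 1) s V)

/-- **★ `ρ_{k+1}(V) ≤ 𝐓ρ_k(V)` AT EVERY FIELD `V`, at every live-selector parameter with the ζ-laws** (`= a.e.` is the known face
`B16RLeafRecord13…densOfRecord₁₃_succ_ae_eq_tdens…`; here the pointwise INEQUALITY, which is what an everywhere-(U) bound consumes).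
[cite: Balaban1989LargeFieldI, (0.2)–(0.4) p.176, p.177 (i)–(ii); Balaban1988Convergent, (2.18) p.257, (3.24)–(3.25) p.270] -/
theorem densOfRecord₁₃_succ_le_tdens_of_liveSel (hζu : IsZetaUnity F N θ.ν θ.τ9.M θ.ζ) (hζa : IsZetaAbsLeOne F N θ.ν θ.τ9.M θ.ζ)
    (hsel : θ.ppSel = ppSelLiveOfRecord F N θ.ν θ.τ9 (EOfRecord₁₃ F N θ) (wOfRecord₉ F N θ.toStage9Params))
    (P : B12.RunParams) (k : ℕ) (V : GaugeField (F.P P.K) (k + 1) (SU N)) :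
    densOfRecord₁₃ F N θ P (k + 1) V ≤ tdensOfRecord₁₃ F N θ P k V := by
  show ∑ s, _ ≤ ∑ s, _
  exact Finset.sum_le_sum fun s _ =>
    mul_le_mul_of_nonneg_left (slotsOfRecord₁₃_succ_le_slotsT_of_liveSel θ hζu hζa hsel P k s V)
      (chiSeqOfRecord_nonneg F N θ.ν θ.τ9.M _ P.K (k + 1) s V)

/-- **Termwise EQUALITY at a history with EMPTY fibre bond set** (`Z′(s) = ∅`, e.g. the all-small history): the post-𝐑 term IS the pre-𝐑 term at every field.
[cite: Balaban1989LargeFieldI, (0.3) p.176 and p.177 (i)–(ii); Balaban1988Convergent, (2.18) p.257] -/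
theorem histTerm₁₃_succ_eq_histTermT_of_fibOfSeq_eq_empty_of_liveSel (hζu : IsZetaUnity F N θ.ν θ.τ9.M θ.ζ) (hζa : IsZetaAbsLeOne F N θ.ν θ.τ9.M θ.ζ)
    (hsel : θ.ppSel = ppSelLiveOfRecord F N θ.ν θ.τ9 (EOfRecord₁₃ F N θ) (wOfRecord₉ F N θ.toStage9Params))
    (P : B12.RunParams) (k : ℕ) {s : SeqOfRecord F θ.ν θ.τ9.M (gOfRecord₁₃ F N θ P) P.K (k + 1)}
    (hfib : fibOfSeq F θ.ν θ.τ9 P (gOfRecord₁₃ F N θ P) (k + 1) s = ∅) (V : GaugeField (F.P P.K) (k + 1) (SU N)) :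
    chiSeqOfRecord F N θ.ν θ.τ9.M (gOfRecord₁₃ F N θ P) P.K (k + 1) s V *
        slotsOfRecord F N θ.ν θ.τ9 (EOfRecord₁₃ F N θ) (wOfRecord₉ F N θ.toStage9Params) θ.ppSel P (gOfRecord₁₃ F N θ P) (k + 1) s V =
      chiSeqOfRecord F N θ.ν θ.τ9.M (gOfRecord₁₃ F N θ P) P.K (k + 1) s V *
        slotsTOfRecord F N θ.ν θ.τ9 (EOfRecord₁₃ F N θ) (wOfRecord₉ F N θ.toStage9Params) θ.ppSel P (gOfRecord₁₃ F N θ P) (k + 1) s V := by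
  rw [slotsOfRecord₁₃_succ_eq_rstepSlot_id_of_liveSel θ hsel P k s V]
  exact chi_mul_rstepSlot_id_eq_of_fibOfSeq_eq_empty _ hfib
    (slotsTOfRecord_nonneg F N θ.ν θ.τ9 (EOfRecord₁₃ F N θ) (wOfRecord₉_nonneg θ hζu hζa) θ.ppSel P _ (k + 1) s V)

end Record

/-! ## §3 THE (UV₁₃) ROW AT LEVEL `k+1` IS 𝐑-FREE: both halves may be supplied on the 𝐓-image -/

section UVRow

variable (θ : Stage13Params F N)

/-- **★★ THE UPPER HALF OF (UV₁₃) AT LEVEL `k+1` FROM THE SAME BOUND FOR THE 𝐓-IMAGE**: a bound `𝐓ρ_k(V) ≤ B` (the consumer's `B = exp(e₊(g_{k+1})·|T₁^{(k+1)}|)`)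
gives `ρ_{k+1}(V) ≤ B` — no estimate on the 𝐑-operation ([IV] (1.1)) is read. [cite: Balaban1989LargeFieldII, (0.1) pp.355–356; Balaban1988Convergent, Cor. 3 (2.50) p.264, (3.24)–(3.25) p.270; Balaban1989LargeFieldI, (0.3) p.176, p.177 (i)–(ii)] -/
theorem uvUpper₁₃_succ_of_tdens_le_of_liveSel (hζu : IsZetaUnity F N θ.ν θ.τ9.M θ.ζ) (hζa : IsZetaAbsLeOne F N θ.ν θ.τ9.M θ.ζ)
    (hsel : θ.ppSel = ppSelLiveOfRecord F N θ.ν θ.τ9 (EOfRecord₁₃ F N θ) (wOfRecord₉ F N θ.toStage9Params))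
    (P : B12.RunParams) (k : ℕ) {V : GaugeField (F.P P.K) (k + 1) (SU N)} {B : ℝ} (hB : tdensOfRecord₁₃ F N θ P k V ≤ B) :
    densOfRecord₁₃ F N θ P (k + 1) V ≤ B :=
  (densOfRecord₁₃_succ_le_tdens_of_liveSel θ hζu hζa hsel P k V).trans hB

/-- **★★ THE UPPER HALF OF (UV₁₃) AT LEVEL `k+1` FROM (U1)ᵀ + (U2)**: per-history majorants of the PRE-𝐑 terms `χ_{k+1}(s)(V)·slotT_{k+1}(s)(V) ≤ major s` and a budget
`Σ_s major s ≤ B` give `ρ_{k+1}(V) ≤ B` — dag-n13-w3's (U1)∕(U2) leaves (`…N13Cor3Repr218LeavesAtRecord13CoPH`) RE-ADDRESSED from the post-𝐑 representation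
`reprOfRecord₁₃` to def-T's 𝐓-image at a live-selector parameter. [cite: Balaban1988Convergent, Cor. 3 (2.50) p.264 («sum of terms similar to (3.42) [6]»), (3.24)–(3.25) p.270; Balaban1989LargeFieldI, (0.3) p.176, p.177 (i)–(ii)] -/
theorem uvUpper₁₃_succ_of_U1T_U2_of_liveSel (hζu : IsZetaUnity F N θ.ν θ.τ9.M θ.ζ) (hζa : IsZetaAbsLeOne F N θ.ν θ.τ9.M θ.ζ)
    (hsel : θ.ppSel = ppSelLiveOfRecord F N θ.ν θ.τ9 (EOfRecord₁₃ F N θ) (wOfRecord₉ F N θ.toStage9Params))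
    (P : B12.RunParams) (k : ℕ) {V : GaugeField (F.P P.K) (k + 1) (SU N)}
    (major : SeqOfRecord F θ.ν θ.τ9.M (gOfRecord₁₃ F N θ P) P.K (k + 1) → ℝ)
    (hU1T : ∀ s, chiSeqOfRecord F N θ.ν θ.τ9.M (gOfRecord₁₃ F N θ P) P.K (k + 1) s V *
        slotsTOfRecord F N θ.ν θ.τ9 (EOfRecord₁₃ F N θ) (wOfRecord₉ F N θ.toStage9Params) θ.ppSel P (gOfRecord₁₃ F N θ P) (k + 1) s V ≤ major s)
    {B : ℝ} (hU2 : ∑ s, major s ≤ B) :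
    densOfRecord₁₃ F N θ P (k + 1) V ≤ B := by
  refine uvUpper₁₃_succ_of_tdens_le_of_liveSel θ hζu hζa hsel P k (le_trans ?_ hU2)
  show ∑ s, _ ≤ ∑ s, _
  exact Finset.sum_le_sum fun s _ => hU1T s

/-- **★★ THE LOWER HALF OF (UV₁₃) AT LEVEL `k+1` FROM (L2)ᵀ AT ONE EMPTY-FIBRE HISTORY**: a lower bound `A ≤ χ_{k+1}(s₀)(V)·slotT_{k+1}(s₀)(V)` for the PRE-𝐑 term of a
history with `Z′(s₀) = ∅` (the all-small history; the consumer's `A = χβ_{k+1}(V)·exp(−g_{k+1}⁻²A^η_{k+1}(V) − e₋|T₁^{(k+1)}|)`) gives `A ≤ ρ_{k+1}(V)`: that term is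
UNCHANGED by 𝐑 (§2) and every other term is `≥ 0` (dag-n13-w3's leaf (L1), here from the ζ-laws). [cite: Balaban1989LargeFieldII, (0.1) pp.355–356; Balaban1988Convergent, Cor. 3 (2.50) p.264, (2.18) p.257; Balaban1989LargeFieldI, (0.3) p.176, p.177 (i)–(ii)] -/
theorem uvLower₁₃_succ_of_L2T_of_fibOfSeq_eq_empty_of_liveSel (hζu : IsZetaUnity F N θ.ν θ.τ9.M θ.ζ) (hζa : IsZetaAbsLeOne F N θ.ν θ.τ9.M θ.ζ)
    (hsel : θ.ppSel = ppSelLiveOfRecord F N θ.ν θ.τ9 (EOfRecord₁₃ F N θ) (wOfRecord₉ F N θ.toStage9Params))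
    (P : B12.RunParams) (k : ℕ) {V : GaugeField (F.P P.K) (k + 1) (SU N)}
    {s₀ : SeqOfRecord F θ.ν θ.τ9.M (gOfRecord₁₃ F N θ P) P.K (k + 1)} (hfib : fibOfSeq F θ.ν θ.τ9 P (gOfRecord₁₃ F N θ P) (k + 1) s₀ = ∅)
    {A : ℝ} (hL2T : A ≤ chiSeqOfRecord F N θ.ν θ.τ9.M (gOfRecord₁₃ F N θ P) P.K (k + 1) s₀ V *
        slotsTOfRecord F N θ.ν θ.τ9 (EOfRecord₁₃ F N θ) (wOfRecord₉ F N θ.toStage9Params) θ.ppSel P (gOfRecord₁₃ F N θ P) (k + 1) s₀ V) :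
    A ≤ densOfRecord₁₃ F N θ P (k + 1) V := by
  rw [← histTerm₁₃_succ_eq_histTermT_of_fibOfSeq_eq_empty_of_liveSel θ hζu hζa hsel P k hfib V] at hL2T
  refine hL2T.trans ?_
  show _ ≤ ∑ s, _
  refine Finset.single_le_sum (f := fun s => chiSeqOfRecord F N θ.ν θ.τ9.M (gOfRecord₁₃ F N θ P) P.K (k + 1) s V *
      slotsOfRecord F N θ.ν θ.τ9 (EOfRecord₁₃ F N θ) (wOfRecord₉ F N θ.toStage9Params) θ.ppSel P (gOfRecord₁₃ F N θ P) (k + 1) s V)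
    (fun s _ => mul_nonneg (chiSeqOfRecord_nonneg F N θ.ν θ.τ9.M _ P.K (k + 1) s V)
      (slotsOfRecord_nonneg F N θ.ν θ.τ9 (EOfRecord₁₃ F N θ) (wOfRecord₉_nonneg θ hζu hζa) θ.ppSel P _ (k + 1) s V)) (Finset.mem_univ s₀)

end UVRow

/-! ## §3b The same three, keyed on node00-def-T's CORE PROVISOS `Provisos₁₃CoPH` (rows `zetaUnity`, `zetaAbs`) of a history-indexed `θ : Stage13HParams` — the K1⁷ engines' key -/

section Provisos

variable (θ : Stage13HParams F N)

/-- **`ρ_{k+1} ≤ 𝐓ρ_k` everywhere, keyed on the core provisos**, at a parameter whose Stage-13 part carries the live selector. [cite: Balaban1989LargeFieldI, (0.2)–(0.4) p.176, p.177 (i)–(ii); Balaban1988Convergent, (3.24)–(3.25) p.270] -/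
theorem densOfRecord₁₃_succ_le_tdens_of_provisos_of_liveSel (h : θ.Provisos₁₃CoPH F N)
    (hsel : θ.ppSel = ppSelLiveOfRecord F N θ.ν θ.τ9 (EOfRecord₁₃ F N θ.toStage13Params) (wOfRecord₉ F N θ.toStage9Params))
    (P : B12.RunParams) (k : ℕ) (V : GaugeField (F.P P.K) (k + 1) (SU N)) :
    densOfRecord₁₃ F N θ.toStage13Params P (k + 1) V ≤ tdensOfRecord₁₃ F N θ.toStage13Params P k V :=
  densOfRecord₁₃_succ_le_tdens_of_liveSel θ.toStage13Params h.zetaUnity h.zetaAbs hsel P k V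

/-- **The upper half at level `k+1` from a bound on the 𝐓-image, keyed on the core provisos.** [cite: Balaban1989LargeFieldII, (0.1) pp.355–356; Balaban1988Convergent, Cor. 3 (2.50) p.264] -/
theorem uvUpper₁₃_succ_of_tdens_le_of_provisos_of_liveSel (h : θ.Provisos₁₃CoPH F N)
    (hsel : θ.ppSel = ppSelLiveOfRecord F N θ.ν θ.τ9 (EOfRecord₁₃ F N θ.toStage13Params) (wOfRecord₉ F N θ.toStage9Params))
    (P : B12.RunParams) (k : ℕ) {V : GaugeField (F.P P.K) (k + 1) (SU N)} {B : ℝ} (hB : tdensOfRecord₁₃ F N θ.toStage13Params P k V ≤ B) :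
    densOfRecord₁₃ F N θ.toStage13Params P (k + 1) V ≤ B :=
  uvUpper₁₃_succ_of_tdens_le_of_liveSel θ.toStage13Params h.zetaUnity h.zetaAbs hsel P k hB

end Provisos

/-! ## §4 AT K0a's STAGE-13 LIVE RE-PIN `θ.liveRepin₁₃` (every witness `theta13LiveOfNumerics … = (…).liveRepin₁₃`, `Node00.theta13LiveOfNumerics_eq`): the selector clause is `rfl` -/

section Repin

variable (θ : Stage13Params F N)

/-- **★ `ρ_{k+1} ≤ 𝐓ρ_k` at every field, AT THE LIVE RE-PIN of any Stage-13 parameter with the ζ-laws** (`ζ` is kept by the re-pin; the selector clause is `rfl` —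
n11-e's `B16RLeafRecord13AtLive.liveRepin₁₃_liveSel`).
[cite: Balaban1989LargeFieldI, (0.2)–(0.4) p.176, p.177 (i)–(ii); Balaban1988Convergent, (3.24)–(3.25) p.270] -/
theorem densOfRecord₁₃_succ_le_tdens_liveRepin₁₃ (hζu : IsZetaUnity F N θ.ν θ.τ9.M θ.ζ) (hζa : IsZetaAbsLeOne F N θ.ν θ.τ9.M θ.ζ)
    (P : B12.RunParams) (k : ℕ) (V : GaugeField (F.P P.K) (k + 1) (SU N)) :
    densOfRecord₁₃ F N (θ.liveRepin₁₃ F N) P (k + 1) V ≤ tdensOfRecord₁₃ F N (θ.liveRepin₁₃ F N) P k V :=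
  densOfRecord₁₃_succ_le_tdens_of_liveSel (θ.liveRepin₁₃ F N) hζu hζa rfl P k V

end Repin

/-! ## §5 LOCATED — the 𝐓-image IS `avgDensity · bracket`: an everywhere bound on `𝐓ρ_k` is a statement about the chosen marginal-density VERSION -/

section Version

open T4AveragingDisintegration (avgDensity avgKernel)

variable (θ : Stage13Params F N)

/-- **THE 𝐓-IMAGE OF RECORD, UNFOLDED THROUGH def-T's (†)** (`Node00.texpASucc_apply`; ANY selector, no hypothesis): `𝐓ρ_k(V′) = avgDensity(V′) · Σ_{s′} χ_{k+1}(s′)(V′)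
· ∫ (w(s′)(U,V′)·χ_k(init s′)(U)·slot_k(init s′)(U)) avgKernel(V′)(dU)`, where `avgDensity = margDensity = rnNN` is Mathlib's chosen `Measure.rnDeriv` version of the
marginal density of Bałaban's block average of record and `avgKernel = Measure.condKernel` the chosen conditional law (both specified only `dV′`-a.e.:
`T4AveragingDisintegration.withDensity_margDensity`, `avgKernel_fibre_ae`). [cite: Balaban1988Convergent, (3.1) p.264, (3.24)–(3.25) p.270; Balaban1987RG1, (0.4) p.253 (bookkeeping over def-T's definition)] -/
theorem tdensOfRecord₁₃_eq_avgDensity_mul_sum (P : B12.RunParams) (k : ℕ) (V' : GaugeField (F.P P.K) (k + 1) (SU N)) :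
    tdensOfRecord₁₃ F N θ P k V' =
      (avgDensity (avOfRecord F N P.K k).avg V' : ℝ) *
        ∑ s' : SeqOfRecord F θ.ν θ.τ9.M (gOfRecord₁₃ F N θ P) P.K (k + 1),
          chiSeqOfRecord F N θ.ν θ.τ9.M (gOfRecord₁₃ F N θ P) P.K (k + 1) s' V' *
            ∫ U, wOfRecord₉ F N θ.toStage9Params P (gOfRecord₁₃ F N θ P) k s' U V' *
                (chiSeqOfRecord F N θ.ν θ.τ9.M (gOfRecord₁₃ F N θ P) P.K k s'.init U *
                  slotsOfRecord F N θ.ν θ.τ9 (EOfRecord₁₃ F N θ) (wOfRecord₉ F N θ.toStage9Params) θ.ppSel P (gOfRecord₁₃ F N θ P) k s'.init U)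
              ∂(avgKernel (avOfRecord F N P.K k).avg V') := by
  rw [Finset.mul_sum]
  show ∑ s', _ = ∑ s', _
  refine Finset.sum_congr rfl fun s' _ => ?_
  rw [slotsTOfRecord_succ]
  unfold tstepOfRecord
  rw [texpASucc_apply]
  ring

/-- **So an EVERYWHERE bound on the 𝐓-image bounds the VERSION times the bracket**: `𝐓ρ_k(V′) ≤ B ⇒ avgDensity(V′)·bracket(V′) ≤ B` at that `V′` (hence `avgDensity(V′)
≤ B∕b` wherever the bracket is `≥ b > 0`).  Read with §2–§3: every road to the UPPER half of (UV₁₃)∕(2.50) at a level `k+1 ≥ 1` through an everywhere bound on `𝐓ρ_k`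
is an everywhere statement about Mathlib's chosen `rnDeriv` version, of which the tree knows only the a.e.-class.  LOCATED; nothing inferred here about provability.
[cite: Balaban1988Convergent, Cor. 3 (2.50) p.264, (3.1) p.264; Balaban1989LargeFieldII, (0.1) pp.355–356 (bookkeeping)] -/
theorem avgDensity_mul_le_of_tdens_le (P : B12.RunParams) (k : ℕ) {V' : GaugeField (F.P P.K) (k + 1) (SU N)} {B : ℝ}
    (hB : tdensOfRecord₁₃ F N θ P k V' ≤ B) :
    (avgDensity (avOfRecord F N P.K k).avg V' : ℝ) *
        ∑ s' : SeqOfRecord F θ.ν θ.τ9.M (gOfRecord₁₃ F N θ P) P.K (k + 1),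
          chiSeqOfRecord F N θ.ν θ.τ9.M (gOfRecord₁₃ F N θ P) P.K (k + 1) s' V' *
            ∫ U, wOfRecord₉ F N θ.toStage9Params P (gOfRecord₁₃ F N θ P) k s' U V' *
                (chiSeqOfRecord F N θ.ν θ.τ9.M (gOfRecord₁₃ F N θ P) P.K k s'.init U *
                  slotsOfRecord F N θ.ν θ.τ9 (EOfRecord₁₃ F N θ) (wOfRecord₉ F N θ.toStage9Params) θ.ppSel P (gOfRecord₁₃ F N θ P) k s'.init U)
              ∂(avgKernel (avOfRecord F N P.K k).avg V') ≤ B := by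
  rwa [tdensOfRecord₁₃_eq_avgDensity_mul_sum θ P k V'] at hB

end Version

end Summit.QuantumFields.YangMills.BalabanUVNodes.N13UVRowRFreeAtLiveSelectorRecord13

end
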